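import Summits.BirchSwinnertonDyer.BirchSwinnertonDyer.Theses.ResidualThetaTransportAtTwo
import HarnessLib

/-!
# Crux Kλ⁺ `ResidualThetaMainConjectureAtTwo` (stmt-BirchSwinnertonDyer-20787, route `ResidualThetaTransportAtTwo`) —
# KERNEL-EXACT READING: modulo the route's own items K0⁺ (`HeckeThetaPartnerAdicAtTwo`) and Kan⁺
# (`ThetaLayerLambdaCongruenceAtTwo`), Kλ⁺ is EXACTLY the λ-part of Kobayashi's `+` main conjecture for `W` at `2`

Cell `bsd-wall`, seat `bsd-wall-rtt-p2` g4 (LEAD PROVER, line `birth`; `--supports` the crux). THEOREMS ONLY — no `def`, no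
named fact, no `sorry`; every research input is an explicit hypothesis (a route decl BY NAME or a spelled-out statement);
nothing about any curve is asserted and BSD is not proved by this.

The λ-PART (Λλ⁺) of Kobayashi's `+` main conjecture at `2` on the habitat⁺, Néron-normalised and up to `2^m` exactly as the
route consumes it (spelled out, no definition): for `W` non-CM of analytic rank `0`, good supersingular at `2` with `a₂ = 0` and
`Δ_W < 0`, cyclotomic `(κ, γ)`, the newform `f` of `W`, `ϖ` with `ϖ·Ω_W = Ω⁺_f`, every Pollack pair `(L⁺, L⁻)` of `f` at `2`,
every signed `+` Selmer dual datum `D` with `X` finitely generated, `Λ`-torsion and `μ(X) = 0`, and every `G ∈ Λ` with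
`ι G = 2^m·ϖ·ι L⁺_W`:  `λ(X) = λ(G)`.

* `residualThetaMainConjectureAtTwo_of_lambdaPart` — **Kan⁺ ∧ (Λλ⁺) ⟹ Kλ⁺** (at a layer where the depleted layer `λ`'s of
  `W` and `g` agree, both sides of Kλ⁺'s defect identity vanish).
* `lambdaPart_of_residualThetaMainConjectureAtTwo` — **K0⁺ ∧ Kan⁺ ∧ Kλ⁺ ⟹ (Λλ⁺)** (take the partner `(M, g, ι, Ω)` of K0⁺ —
  a cohomological plus period is a plus period — and the admissible odd `S₀` = places over the odd prime factors of `N_W·M`,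
  PROVED to exist by `MultTransportAtTwo.exists_oddPlaces`; evaluate Kan⁺ and Kλ⁺ at a common large even layer; this is the
  `λ(X) = λ(G)` step of the route's `closes`, isolated).
Hence, on K0⁺ ∧ Kan⁺ (K0⁺: Ribet/Shimura CM newform partner, printed; Kan⁺: the analytic layer congruence, numerically equal on
22/22 + 13/13 pairs of DRTT1-RESULT-v1), **Kλ⁺ ⟺ (Λλ⁺)**: the crux carries neither more nor less than the λ-equality
`λ(X⁺(W/ℚ_∞)) = λ(2^m ϖ L⁺_W)` for the non-CM curve `W` at `p = 2` — the half of Kobayashi's main conjecture that Kato's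
divisibility (K3, `λ(X) ≤ λ(G)`) does not give. Together with the landed composition
`residualThetaMainConjectureAtTwo_of_residualCounts` (p587229: Kλ⁺ ⟸ item 23110 ∧ (RMC)) this is the line's complete account:
(Λλ⁺) ⟸ K0⁺ ∧ Kan⁺ ∧ 23110 ∧ (RMC), and no W-only argument inside the line reaches (Λλ⁺).

References: [Kobayashi2003] Conjecture (p. 2), Thm. 1.2/4.1; [PollackWeston2011MT] §3.1 (layer `λ`); [GreenbergVatsal2000] §2.
-/

set_option autoImplicit false
-- D-0017: single-problem summit, so `Summit.BirchSwinnertonDyer.BirchSwinnertonDyer.…` repeats a namespace BY DESIGN.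
set_option linter.dupNamespace false

noncomputable section

open scoped Classical

namespace Summit.BirchSwinnertonDyer.BirchSwinnertonDyer.Theorems.ResidualThetaLayer

/-- **Kan⁺ ∧ (Λλ⁺) ⟹ Kλ⁺.** If the depleted Mazur–Tate layers of `W` and of the partner `g` have equal layer `λ` for all
large even `n` (Kan⁺, route item `ThetaLayerLambdaCongruenceAtTwo` BY NAME) and the λ-part of Kobayashi's `+` main conjecture
holds for `W` at `2` (hypothesis `hMC`, spelled out: `λ(X) = λ(G)` whenever `ι G = 2^m ϖ ι L⁺_W`, for torsion `μ = 0` data),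
then the crux `ResidualThetaMainConjectureAtTwo` holds: at every such layer both sides of its defect identity are `0`. -/
theorem residualThetaMainConjectureAtTwo_of_lambdaPart
    (han : Summit.BirchSwinnertonDyer.BirchSwinnertonDyer.Theses.ResidualThetaTransportAtTwo.ThetaLayerLambdaCongruenceAtTwo)
    (hMC : ∀ (W : WeierstrassCurve ℚ) [W.IsElliptic] [W.IsGloballyMinimal], ¬ W.HasCM → W.analyticRank = 0 → Literature.NumberTheory.EllipticCurves.Rank1Residual.GoodSS W 2 → W.frobeniusTrace 2 = 0 → W.Δ < 0 → ∀ (κ : Literature.NumberTheory.EllipticCurves.ZpExtension ℚ 2) (γ : Field.absoluteGaloisGroup ℚ), κ.IsCyclotomic → κ.IsTopGenerator γ → Literature.NumberTheory.EllipticCurves.IsCyclotomicVariable 2 γ → ∀ [NeZero (W.conductorNorm ℤ)] (f : CuspForm (CongruenceSubgroup.Gamma0 (W.conductorNorm ℤ)) 2), Literature.NumberTheory.EllipticCurves.ModularForms.IsNewformOf W f → ∀ (ϖ : ℚ), (ϖ : ℝ) * W.realPeriodRat = Literature.NumberTheory.EllipticCurves.ModularForms.plusPeriod f → ∀ (Lplus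 Lminus : Literature.NumberTheory.EllipticCurves.IwasawaAlgebra 2), Summit.BirchSwinnertonDyer.Rank1Residual.Supersingular.IsPollackPair f 2 Lplus Lminus → ∀ (D : Literature.NumberTheory.EllipticCurves.Kobayashi2003.SignedSelmerDualData W κ γ 1) [Module.Finite (Literature.NumberTheory.EllipticCurves.IwasawaAlgebra 2) D.X], Module.IsTorsion (Literature.NumberTheory.EllipticCurves.IwasawaAlgebra 2) D.X → D.mu = 0 → ∀ (G : Literature.NumberTheory.EllipticCurves.IwasawaAlgebra 2) (m : ℕ), Literature.NumberTheory.EllipticCurves.iwasawaToPowerSeries 2 G = PowerSeries.C ((2 : ℚ_[2]) ^ m * (ϖ : ℚ_[2])) * Literature.NumberTheory.EllipticCurves.iwasawaToPowerSeries 2 (Summit.BirchSwinnertonDyer.Rank1Residual.Supersingular.kobayashiL 1 Lplus Lminus) → Literature.NumberTheory.EllipticCurves.lambdaInvariant 2 D.X = Summit.BirchSwinnertonDyer.Rank1Residual.X1.MuLambda.lam G) :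
    Summit.BirchSwinnertonDyer.BirchSwinnertonDyer.Theses.ResidualThetaTransportAtTwo.ResidualThetaMainConjectureAtTwo := by
  intro W _ _ hcm hr hss ha hΔ M _ g ι Ω hodd hnew hcmg ha2 hΩ hcong κ γ hκ hγ hcv _ f hf ϖ hϖ Lplus Lminus hPP S₀ hS2 hSW hSM
    D _ hX hμ G m hG
  obtain ⟨n₀, hn₀⟩ := han W hcm hr hss ha hΔ M g ι Ω hodd hnew hcmg ha2 hΩ hcong f hf S₀ hS2 hSW hSM
  have hlam0 := hMC W hcm hr hss ha hΔ κ γ hκ hγ hcv f hf ϖ hϖ Lplus Lminus hPP D hX hμ G m hG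
  refine ⟨n₀, fun n hn he ↦ ?_⟩
  rw [hn₀ n hn he, hlam0, sub_self, sub_self]

/-- **K0⁺ ∧ Kan⁺ ∧ Kλ⁺ ⟹ (Λλ⁺)** — the `λ(X) = λ(G)` step of the route's deciding theorem, isolated: for `W` on the
habitat⁺ take the `2`-adic Hecke theta partner `(M, g, ι, Ω)` of K0⁺ (`HeckeThetaPartnerAdicAtTwo` BY NAME; its cohomological
plus period is a plus period), the admissible odd `S₀` of places over the odd prime factors of `N_W · M` (PROVED:
`MultTransportAtTwo.exists_oddPlaces`, good reduction off `S₀` by `SignedTransportAtTwo.hasGoodReductionAt_of_two_mem` and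
`MultTransportAtTwo.hasGoodReductionAt_of_notMem_oddPlaces`), and read Kan⁺ (`ThetaLayerLambdaCongruenceAtTwo`) and Kλ⁺
(`ResidualThetaMainConjectureAtTwo`) at the common even layer `2·max(n₁, n₂)`: the defect vanishes, so `λ(X) = λ(G)`. -/
theorem lambdaPart_of_residualThetaMainConjectureAtTwo
    (hP : Summit.BirchSwinnertonDyer.BirchSwinnertonDyer.Theses.ResidualThetaTransportAtTwo.HeckeThetaPartnerAdicAtTwo)
    (han : Summit.BirchSwinnertonDyer.BirchSwinnertonDyer.Theses.ResidualThetaTransportAtTwo.ThetaLayerLambdaCongruenceAtTwo)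
    (hlam : Summit.BirchSwinnertonDyer.BirchSwinnertonDyer.Theses.ResidualThetaTransportAtTwo.ResidualThetaMainConjectureAtTwo) :
    ∀ (W : WeierstrassCurve ℚ) [W.IsElliptic] [W.IsGloballyMinimal], ¬ W.HasCM → W.analyticRank = 0 → Literature.NumberTheory.EllipticCurves.Rank1Residual.GoodSS W 2 → W.frobeniusTrace 2 = 0 → W.Δ < 0 → ∀ (κ : Literature.NumberTheory.EllipticCurves.ZpExtension ℚ 2) (γ : Field.absoluteGaloisGroup ℚ), κ.IsCyclotomic → κ.IsTopGenerator γ → Literature.NumberTheory.EllipticCurves.IsCyclotomicVariable 2 γ → ∀ [NeZero (W.conductorNorm ℤ)] (f : CuspForm (CongruenceSubgroup.Gamma0 (W.conductorNorm ℤ)) 2), Literature.NumberTheory.EllipticCurves.ModularForms.IsNewformOf W f → ∀ (ϖ : ℚ), (ϖ : ℝ) * W.realPeriodRat = Literature.NumberTheory.EllipticCurves.ModularForms.plusPeriod f → ∀ (Lplus Lminus : Literature.NumberTheory.EllipticCurves.IwasawaAlgebra 2), Summit.BirchSwinnertonDyer.Rank1Residual.Supersingular.IsPollackPair f 2 Lplus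 Lminus → ∀ (D : Literature.NumberTheory.EllipticCurves.Kobayashi2003.SignedSelmerDualData W κ γ 1) [Module.Finite (Literature.NumberTheory.EllipticCurves.IwasawaAlgebra 2) D.X], Module.IsTorsion (Literature.NumberTheory.EllipticCurves.IwasawaAlgebra 2) D.X → D.mu = 0 → ∀ (G : Literature.NumberTheory.EllipticCurves.IwasawaAlgebra 2) (m : ℕ), Literature.NumberTheory.EllipticCurves.iwasawaToPowerSeries 2 G = PowerSeries.C ((2 : ℚ_[2]) ^ m * (ϖ : ℚ_[2])) * Literature.NumberTheory.EllipticCurves.iwasawaToPowerSeries 2 (Summit.BirchSwinnertonDyer.Rank1Residual.Supersingular.kobayashiL 1 Lplus Lminus) → Literature.NumberTheory.EllipticCurves.lambdaInvariant 2 D.X = Summit.BirchSwinnertonDyer.Rank1Residual.X1.MuLambda.lam G := by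
  intro W _ _ hcm hr hss ha hΔ κ γ hκ hγ hcv _ f hf ϖ hϖ Lplus Lminus hPP D _ hX hμ G m hG
  -- the 2-adic Hecke theta partner of W (K0⁺)
  obtain ⟨M, iM, g, ι, Ω, hodd, hnew, hcmg, ha2g, hΩ, hcong⟩ := hP W hcm hr hss ha hΔ
  -- an admissible S₀: the places above the odd prime factors of N_W · M (PROVED, as in the route's `closes`)
  obtain ⟨S₀, hS₀2, hS₀W, hS₀M⟩ : ∃ S₀ : Finset (IsDedekindDomain.HeightOneSpectrum (NumberField.RingOfIntegers ℚ)),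
      (∀ v ∈ S₀, ((2 : ℕ) : NumberField.RingOfIntegers ℚ) ∉ v.asIdeal) ∧
      (∀ v : IsDedekindDomain.HeightOneSpectrum (NumberField.RingOfIntegers ℚ), ¬ W.HasGoodReductionAt v → v ∈ S₀) ∧
      (∀ v : IsDedekindDomain.HeightOneSpectrum (NumberField.RingOfIntegers ℚ), Rat.HeightOneSpectrum.natGenerator v ∣ M → v ∈ S₀) := by
    set S : Finset ℕ := (W.conductorNorm ℤ).primeFactors ∪ M.primeFactors with hS_def
    have hS : ∀ ℓ ∈ S, ℓ.Prime := by
      intro ℓ hℓ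
      rcases Finset.mem_union.mp hℓ with h | h <;> exact Nat.prime_of_mem_primeFactors h
    obtain ⟨S₀, hS₀⟩ := Summit.BirchSwinnertonDyer.BirchSwinnertonDyer.Theorems.MultTransportAtTwo.exists_oddPlaces S hS
    refine ⟨S₀, Summit.BirchSwinnertonDyer.BirchSwinnertonDyer.Theorems.MultTransportAtTwo.two_notMem_of_mem_oddPlaces S₀ hS₀,
      fun v hv ↦ ?_, fun v hv ↦ ?_⟩
    · by_contra hvS
      by_cases h2 : ((2 : ℕ) : NumberField.RingOfIntegers ℚ) ∈ v.asIdeal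
      · exact hv (Summit.BirchSwinnertonDyer.BirchSwinnertonDyer.Theorems.SignedTransportAtTwo.hasGoodReductionAt_of_two_mem W hss.1 v h2)
      · exact hv (Summit.BirchSwinnertonDyer.BirchSwinnertonDyer.Theorems.MultTransportAtTwo.hasGoodReductionAt_of_notMem_oddPlaces S₀ hS₀ W
          Finset.subset_union_left v hvS h2)
    · rw [hS₀ v]
      have hM0 : M ≠ 0 := NeZero.ne M
      refine ⟨Finset.mem_union_right _ (Nat.mem_primeFactors.2 ⟨Rat.HeightOneSpectrum.prime_natGenerator v, hv, hM0⟩), ?_⟩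
      intro h2
      apply Nat.not_even_iff_odd.2 hodd
      exact even_iff_two_dvd.2 (h2 ▸ hv)
  -- Kan⁺ and Kλ⁺ at a common large even layer
  obtain ⟨n₁, hn₁⟩ := han W hcm hr hss ha hΔ M g ι Ω hodd hnew hcmg ha2g hΩ.isPlusPeriod hcong f hf S₀ hS₀2 hS₀W hS₀M
  obtain ⟨n₂, hn₂⟩ := hlam W hcm hr hss ha hΔ M g ι Ω hodd hnew hcmg ha2g hΩ.isPlusPeriod hcong κ γ hκ hγ hcv f hf ϖ hϖ
    Lplus Lminus hPP S₀ hS₀2 hS₀W hS₀M D hX hμ G m hG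
  have h1 := hn₁ (2 * max n₁ n₂) (by omega) (even_two_mul _)
  have h2 := hn₂ (2 * max n₁ n₂) (by omega) (even_two_mul _)
  rw [h1, sub_self, sub_eq_zero] at h2
  exact_mod_cast h2

/-- COROLLARY (the reading in one line): on K0⁺ ∧ Kan⁺, **Kλ⁺ ⟺ (Λλ⁺)**. -/
theorem residualThetaMainConjectureAtTwo_iff_lambdaPart
    (hP : Summit.BirchSwinnertonDyer.BirchSwinnertonDyer.Theses.ResidualThetaTransportAtTwo.HeckeThetaPartnerAdicAtTwo)
    (han : Summit.BirchSwinnertonDyer.BirchSwinnertonDyer.Theses.ResidualThetaTransportAtTwo.ThetaLayerLambdaCongruenceAtTwo) :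
    Summit.BirchSwinnertonDyer.BirchSwinnertonDyer.Theses.ResidualThetaTransportAtTwo.ResidualThetaMainConjectureAtTwo ↔
    (∀ (W : WeierstrassCurve ℚ) [W.IsElliptic] [W.IsGloballyMinimal], ¬ W.HasCM → W.analyticRank = 0 → Literature.NumberTheory.EllipticCurves.Rank1Residual.GoodSS W 2 → W.frobeniusTrace 2 = 0 → W.Δ < 0 → ∀ (κ : Literature.NumberTheory.EllipticCurves.ZpExtension ℚ 2) (γ : Field.absoluteGaloisGroup ℚ), κ.IsCyclotomic → κ.IsTopGenerator γ → Literature.NumberTheory.EllipticCurves.IsCyclotomicVariable 2 γ → ∀ [NeZero (W.conductorNorm ℤ)] (f : CuspForm (CongruenceSubgroup.Gamma0 (W.conductorNorm ℤ)) 2), Literature.NumberTheory.EllipticCurves.ModularForms.IsNewformOf W f → ∀ (ϖ : ℚ), (ϖ : ℝ) * W.realPeriodRat = Literature.NumberTheory.EllipticCurves.ModularForms.plusPeriod f → ∀ (Lplus Lminus : Literature.NumberTheory.EllipticCurves.IwasawaAlgebra 2), Summit.BirchSwinnertonDyer.Rank1Residual.Supersingular.IsPollackPair f 2 Lplus Lminus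 → ∀ (D : Literature.NumberTheory.EllipticCurves.Kobayashi2003.SignedSelmerDualData W κ γ 1) [Module.Finite (Literature.NumberTheory.EllipticCurves.IwasawaAlgebra 2) D.X], Module.IsTorsion (Literature.NumberTheory.EllipticCurves.IwasawaAlgebra 2) D.X → D.mu = 0 → ∀ (G : Literature.NumberTheory.EllipticCurves.IwasawaAlgebra 2) (m : ℕ), Literature.NumberTheory.EllipticCurves.iwasawaToPowerSeries 2 G = PowerSeries.C ((2 : ℚ_[2]) ^ m * (ϖ : ℚ_[2])) * Literature.NumberTheory.EllipticCurves.iwasawaToPowerSeries 2 (Summit.BirchSwinnertonDyer.Rank1Residual.Supersingular.kobayashiL 1 Lplus Lminus) → Literature.NumberTheory.EllipticCurves.lambdaInvariant 2 D.X = Summit.BirchSwinnertonDyer.Rank1Residual.X1.MuLambda.lam G) :=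
  ⟨lambdaPart_of_residualThetaMainConjectureAtTwo hP han, residualThetaMainConjectureAtTwo_of_lambdaPart han⟩

end Summit.BirchSwinnertonDyer.BirchSwinnertonDyer.Theorems.ResidualThetaLayer

end
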